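import Literature.NumberTheory.Automorphic.ShimuraCurve
import Literature.NumberTheory.Automorphic.QuaternionLocalSplit
import Literature.NumberTheory.Automorphic.QuaternionInvolutionToolkit
import Literature.NumberTheory.Automorphic.QuaternionAlgebraAdelicReducedNormProofs
import HarnessLib

/-!
# Lattice points in a cone vs. principal left ideals: the sandwich
# `N(F₀, T) ≤ 2 · #{O α : α ∈ O, 0 < nrd α ≤ T} ≤ N(F₁, T)` for a Shimura curve datum
# (Eichler's lattice-point method; Vignéras, LNM 800, Ch. IV §1, Ch. V §2; Shimizu 1963 §3)

Topic `NumberTheory/Automorphic`; theorems only (no definition, no named fact, no instance).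
Let `X : ShimuraCurveData D M` (`ShimuraCurve.lean`), `Γ = Γ₀^D(M) = ι(O¹)`, and let
`F₀ ⊆ F₁ ⊆ ℍ` be a pair of sets such that every `Γ`-orbit meets `F₁` and two points of `F₀` in
the same orbit differ by `±1` only (the Dirichlet pair of `FuchsianDirichletDomain.lean`). For
`S ⊆ ℍ` and `T` write

* `N(S, T) = #{α ∈ O : 0 < nrd α ≤ T, ι(α) • i ∈ S}` — the lattice points of `ι(O)` in the cone
  over `S` (the set whose asymptotics is governed by the cone volume, `MatrixConeHyperbolicVolume`),
* `A(T) = #{O α : α ∈ O, 0 < nrd α ≤ T}` — the number of principal left ideals of `O` having a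
  generator of positive reduced norm `≤ T` (counted as subsets `O α ⊆ B`).

Then (`ShimuraCurveData.two_mul_card_leftIdeals_le`, `ShimuraCurveData.card_coneElems_le`):

  `N(F₀, T) ≤ 2 A(T) ≤ N(F₁, T)`.

Indeed `Γ` acts on the cone by left multiplication, `ι(u) · ι(α) = ι(u α)`, compatibly with its
action on `ℍ`; the orbit `O¹ α` is exactly the set of generators of `O α` of the same (positive)
norm as `α` (two generators differ by a unit of `O`, whose norm `±1` must be `+1`); every orbit has
the two points `±α` over `F₁` (covering), and at most the two points `±α` over `F₀` (uniqueness up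
to `±1`). This is the bookkeeping between "nombre de points du réseau dans un domaine fondamental
du groupe des unités" and "nombre d'idéaux principaux" in Eichler's method (Vignéras V §2, proof of
Prop. 2.2 / Cor. 2.3 in the definite case; IV §1 for the Fuchsian group), brick "I3" of the
`D > 1` branch of the proof of `Literature.NumberTheory.Automorphic.ShimuraCurveData.volume_fd_eq`.

## References

* M.-F. Vignéras, *Arithmétique des algèbres de quaternions*, LNM 800 (1980), Ch. IV §1,
  Ch. V §2 [VignerasLNM800].
* H. Shimizu, On discontinuous groups operating on the product of the upper half planes,
  Ann. of Math. 77 (1963), §3 [Shimizu1963].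
-/

noncomputable section

open scoped MatrixGroups

namespace Literature.NumberTheory.Automorphic

namespace ShimuraCurveData

variable {D M : ℕ} (X : ShimuraCurveData D M)

/-! ### 1. `det ι(α) = nrd α`; units of `O` of positive norm act through `Γ` -/

/-- `det ι(α) = nrd(α)` in `ℝ` (tree `AlgHom.det_eq_reducedNorm`). [cite: VignerasLNM800, Ch. I §1 Lemme 1.1] -/
theorem det_ι (α : X.B) : (X.ι α).det = ((reducedNorm ℚ X.B α : ℚ) : ℝ) := by
  rw [AlgHom.det_eq_reducedNorm, eq_ratCast]

/-- `nrd 0 = 0`. [folklore] -/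
theorem reducedNorm_zero : reducedNorm ℚ X.B 0 = 0 := by
  have h := reducedNorm_smul ℚ (0 : ℚ) (0 : X.B)
  rwa [zero_smul, zero_pow two_ne_zero, zero_mul] at h

/-- An element of positive reduced norm is not `2`-torsion: `-α ≠ α`. [folklore] -/
theorem neg_ne_self_of_reducedNorm_pos {α : X.B} (hα0 : 0 < reducedNorm ℚ X.B α) : -α ≠ α := by
  intro h
  have h2 : (2 : ℚ) • α = 0 := by rw [two_smul]; nth_rewrite 1 [← h]; rw [neg_add_cancel]
  rw [smul_eq_zero] at h2
  rcases h2 with h2 | h2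
  · norm_num at h2
  · rw [h2, reducedNorm_zero] at hα0
    exact lt_irrefl _ hα0

/-- `nrd` takes integer values on `O`. [cite: VignerasLNM800, Ch. I §4 Lemme 4.12] -/
theorem exists_int_reducedNorm_eq {α : X.B} (hα : α ∈ X.O) : ∃ n : ℤ, reducedNorm ℚ X.B α = n := by
  obtain ⟨-, n, -, hn⟩ := X.isOrder.exists_int_reducedTrace_reducedNorm hα
  exact ⟨n, hn⟩

/-- `ι` detects `1` and `-1`. [folklore] -/
theorem eq_one_or_neg_one_of_ι {u : X.B} (h : X.ι u = 1 ∨ X.ι u = -1) : u = 1 ∨ u = -1 := by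
  rcases h with h | h
  · left; exact X.ι_injective (by rw [h, map_one])
  · right; exact X.ι_injective (by rw [h, map_neg, map_one])

/-- The left ideal `O α` as a subset of `B`: membership. [folklore] -/
theorem mem_image_mul_right_iff {α x : X.B} :
    x ∈ (fun o : X.B => o * α) '' (X.O : Set X.B) ↔ ∃ o ∈ X.O, o * α = x := by
  simp only [Set.mem_image, SetLike.mem_coe]

/-- `O (-α) = O α`. [folklore] -/
theorem image_mul_right_neg (α : X.B) :
    (fun o : X.B => o * -α) '' (X.O : Set X.B) = (fun o : X.B => o * α) '' (X.O : Set X.B) := by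
  ext x
  simp only [Set.mem_image, SetLike.mem_coe]
  constructor
  · rintro ⟨o, ho, rfl⟩; exact ⟨-o, X.O.neg_mem ho, by rw [neg_mul, mul_neg]⟩
  · rintro ⟨o, ho, rfl⟩; exact ⟨-o, X.O.neg_mem ho, by rw [neg_mul, mul_neg, neg_neg]⟩

/-- **Translating a generator by `Γ`**: for `α ∈ O` and `γ ∈ Γ = ι(O¹)` there is `α' ∈ O` with the
same reduced norm, generating the same left ideal `O α' = O α`, and `ι(α') = γ ι(α)` (namely
`α' = u α` for the unit `u ∈ O¹` with `ι(u) = γ`). [folklore] -/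
theorem exists_mem_ι_eq_mul {α : X.B} (hα : α ∈ X.O) {γ : GL (Fin 2) ℝ} (hγ : γ ∈ X.Gamma) :
    ∃ α' ∈ X.O, reducedNorm ℚ X.B α' = reducedNorm ℚ X.B α ∧
      (fun o : X.B => o * α') '' (X.O : Set X.B) = (fun o : X.B => o * α) '' (X.O : Set X.B) ∧
      X.ι α' = (γ : Matrix (Fin 2) (Fin 2) ℝ) * X.ι α := by
  obtain ⟨⟨u, hu, huγ⟩, ⟨v, hv, hvγ⟩, hdet⟩ := hγ
  have hvu : v * u = 1 := X.ι_injective (by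
    rw [map_mul, map_one, huγ, hvγ, ← Units.val_mul, inv_mul_cancel, Units.val_one])
  refine ⟨u * α, X.isOrder.mul_mem u hu α hα, ?_, ?_, by rw [map_mul, huγ]⟩
  · apply (algebraMap ℚ ℝ).injective
    rw [← AlgHom.det_eq_reducedNorm X.ι, ← AlgHom.det_eq_reducedNorm X.ι, map_mul, Matrix.det_mul,
      huγ, ← Matrix.GeneralLinearGroup.val_det_apply, hdet, Units.val_one, one_mul]
  · ext x
    simp only [Set.mem_image, SetLike.mem_coe]
    constructor
    · rintro ⟨o, ho, rfl⟩
      exact ⟨o * u, X.isOrder.mul_mem o ho u hu, by rw [mul_assoc]⟩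
    · rintro ⟨o, ho, rfl⟩
      refine ⟨o * v, X.isOrder.mul_mem o ho v hv, ?_⟩
      rw [mul_assoc, ← mul_assoc v, hvu, one_mul]

/-- **Two generators of positive norm of the same left ideal differ by `Γ`**: if `α, β` have
positive reduced norms and `O α = O β` (so that `α, β ∈ O`), then `ι(β) = γ ι(α)` for some `γ ∈ Γ` (`β = u α` with
`u ∈ O^×`, and `nrd u = nrd β / nrd α > 0` forces `nrd u = 1`). [folklore] -/
theorem exists_mem_Gamma_ι_eq_mul {α β : X.B}
    (hα0 : 0 < reducedNorm ℚ X.B α) (hβ0 : 0 < reducedNorm ℚ X.B β)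
    (heq : (fun o : X.B => o * α) '' (X.O : Set X.B) = (fun o : X.B => o * β) '' (X.O : Set X.B)) :
    ∃ γ ∈ X.Gamma, X.ι β = (γ : Matrix (Fin 2) (Fin 2) ℝ) * X.ι α := by
  -- `β = u α`, `α = v β`
  obtain ⟨u, hu, huα⟩ : ∃ u ∈ X.O, u * α = β :=
    X.mem_image_mul_right_iff.mp (heq ▸ X.mem_image_mul_right_iff.mpr ⟨1, X.isOrder.one_mem, one_mul β⟩)
  obtain ⟨v, hv, hvβ⟩ : ∃ v ∈ X.O, v * β = α :=
    X.mem_image_mul_right_iff.mp (heq.symm ▸ X.mem_image_mul_right_iff.mpr ⟨1, X.isOrder.one_mem, one_mul α⟩)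
  have hαu : IsUnit α := IsQuaternionAlgebra.isUnit_of_reducedNorm_ne_zero hα0.ne'
  have hvu : v * u = 1 := by
    obtain ⟨w, hw⟩ := hαu
    have h : (v * u) * α = 1 * α := by rw [mul_assoc, huα, hvβ, one_mul]
    rw [← hw] at h
    exact (Units.mul_left_inj w).mp h
  -- norms
  obtain ⟨nu, hnu⟩ := X.exists_int_reducedNorm_eq hu
  obtain ⟨nv, hnv⟩ := X.exists_int_reducedNorm_eq hv
  have hdetu : (X.ι u).det = (nu : ℝ) := by rw [X.det_ι, hnu]; push_cast; rfl
  have hdetv : (X.ι v).det = (nv : ℝ) := by rw [X.det_ι, hnv]; push_cast; rfl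
  have hprod : (nv : ℝ) * nu = 1 := by
    rw [← hdetu, ← hdetv, ← Matrix.det_mul, ← map_mul, hvu, map_one, Matrix.det_one]
  have hpos : (0 : ℝ) < nu := by
    have h : ((reducedNorm ℚ X.B β : ℚ) : ℝ) = (nu : ℝ) * ((reducedNorm ℚ X.B α : ℚ) : ℝ) := by
      rw [← X.det_ι, ← X.det_ι, ← hdetu, ← Matrix.det_mul, ← map_mul, huα]
    have hα' : (0 : ℝ) < ((reducedNorm ℚ X.B α : ℚ) : ℝ) := by exact_mod_cast hα0
    have hβ' : (0 : ℝ) < ((reducedNorm ℚ X.B β : ℚ) : ℝ) := by exact_mod_cast hβ0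
    rw [h] at hβ'
    exact (mul_pos_iff_of_pos_right hα').mp hβ'
  have hnu1 : nu = 1 := by
    have h1 : nv * nu = 1 := by exact_mod_cast hprod
    exact Int.eq_one_of_mul_eq_one_left (by exact_mod_cast hpos.le) h1
  have hdet1 : (X.ι u).det = 1 := by rw [hdetu, hnu1, Int.cast_one]
  -- the element of `Γ`
  set γ : GL (Fin 2) ℝ := Matrix.GeneralLinearGroup.mkOfDetNeZero (X.ι u) (by rw [hdet1]; exact one_ne_zero)
    with hγ
  have hγval : (γ : Matrix (Fin 2) (Fin 2) ℝ) = X.ι u := rfl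
  have hγinv : ((γ⁻¹ : GL (Fin 2) ℝ) : Matrix (Fin 2) (Fin 2) ℝ) = X.ι v := by
    rw [Matrix.coe_units_inv, hγval]
    exact Matrix.inv_eq_left_inv (by rw [← map_mul, hvu, map_one])
  refine ⟨γ, ⟨⟨u, hu, hγval.symm⟩, ⟨v, hv, hγinv.symm⟩, ?_⟩, by rw [hγval, ← map_mul, huα]⟩
  ext
  rw [Matrix.GeneralLinearGroup.val_det_apply, hγval, hdet1, Units.val_one]

/-! ### 2. `2 A(T) ≤ N(F₁, T)` -/

/-- The `GL₂(ℝ)` element of `ι(α)` for `nrd α ≠ 0`. [folklore] -/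
theorem exists_gl_val_eq_ι {α : X.B} (hα : reducedNorm ℚ X.B α ≠ 0) :
    ∃ g : GL (Fin 2) ℝ, (g : Matrix (Fin 2) (Fin 2) ℝ) = X.ι α :=
  ⟨Matrix.GeneralLinearGroup.mkOfDetNeZero (X.ι α) (by rw [X.det_ι]; exact_mod_cast hα), rfl⟩

/-- **`2 A(T) ≤ N(F₁, T)`.** If every `Γ`-orbit of `ℍ` meets `F₁`, then every principal left ideal
`O α` (`α ∈ O`, `0 < nrd α ≤ T`) has two generators `±α'` of norm `nrd α` with `ι(±α') • i ∈ F₁`;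
distinct ideals have distinct generators. Hence, if the lattice points over `F₁` are finitely many,
so are the ideals, and twice their number is at most the number of lattice points. [cite: VignerasLNM800, Ch. IV §1, Ch. V §2 (preuve de la formule de masse)] -/
theorem two_mul_card_leftIdeals_le (F₁ : Set UpperHalfPlane) (T : ℝ)
    (hcov : ∀ z : UpperHalfPlane, ∃ γ ∈ X.Gamma, γ • z ∈ F₁)
    (hfin : {α : X.B | α ∈ X.O ∧ 0 < reducedNorm ℚ X.B α ∧ ((reducedNorm ℚ X.B α : ℚ) : ℝ) ≤ T ∧
      ∃ g : GL (Fin 2) ℝ, (g : Matrix (Fin 2) (Fin 2) ℝ) = X.ι α ∧ g • UpperHalfPlane.I ∈ F₁}.Finite) :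
    {I : Set X.B | ∃ α ∈ X.O, 0 < reducedNorm ℚ X.B α ∧ ((reducedNorm ℚ X.B α : ℚ) : ℝ) ≤ T ∧
        I = (fun o : X.B => o * α) '' (X.O : Set X.B)}.Finite ∧
      2 * Nat.card {I : Set X.B | ∃ α ∈ X.O, 0 < reducedNorm ℚ X.B α ∧
          ((reducedNorm ℚ X.B α : ℚ) : ℝ) ≤ T ∧ I = (fun o : X.B => o * α) '' (X.O : Set X.B)} ≤
        Nat.card {α : X.B | α ∈ X.O ∧ 0 < reducedNorm ℚ X.B α ∧ ((reducedNorm ℚ X.B α : ℚ) : ℝ) ≤ T ∧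
          ∃ g : GL (Fin 2) ℝ, (g : Matrix (Fin 2) (Fin 2) ℝ) = X.ι α ∧ g • UpperHalfPlane.I ∈ F₁} := by
  classical
  set CE : Set X.B := {α : X.B | α ∈ X.O ∧ 0 < reducedNorm ℚ X.B α ∧
    ((reducedNorm ℚ X.B α : ℚ) : ℝ) ≤ T ∧
      ∃ g : GL (Fin 2) ℝ, (g : Matrix (Fin 2) (Fin 2) ℝ) = X.ι α ∧ g • UpperHalfPlane.I ∈ F₁} with hCE
  set LI : Set (Set X.B) := {I : Set X.B | ∃ α ∈ X.O, 0 < reducedNorm ℚ X.B α ∧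
    ((reducedNorm ℚ X.B α : ℚ) : ℝ) ≤ T ∧ I = (fun o : X.B => o * α) '' (X.O : Set X.B)} with hLI
  haveI : Finite CE := hfin.to_subtype
  -- a generator over `F₁` for every ideal
  have key : ∀ I : LI, ∃ α : X.B, α ∈ CE ∧ (I : Set X.B) = (fun o : X.B => o * α) '' (X.O : Set X.B) := by
    rintro ⟨I, α, hα, hα0, hαT, rfl⟩
    obtain ⟨g, hg⟩ := X.exists_gl_val_eq_ι hα0.ne'
    obtain ⟨γ, hγ, hγz⟩ := hcov (g • UpperHalfPlane.I)
    obtain ⟨α', hα', hnrd, hideal, hι⟩ := X.exists_mem_ι_eq_mul hα hγ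
    refine ⟨α', ⟨hα', by rw [hnrd]; exact hα0, by rw [hnrd]; exact hαT, γ * g, ?_, ?_⟩, hideal.symm⟩
    · rw [Units.val_mul, hg, hι]
    · rwa [mul_smul]
  choose f hfCE hfI using key
  -- `-α` is again a lattice point over `F₁`
  have hneg : ∀ α ∈ CE, -α ∈ CE := by
    rintro α ⟨hα, hα0, hαT, g, hg, hgz⟩
    refine ⟨X.O.neg_mem hα, by rw [reducedNorm_neg ℚ]; exact hα0, by rw [reducedNorm_neg ℚ]; exact hαT,
      -g, by rw [Units.val_neg, hg, map_neg], by rwa [UpperHalfPlane.neg_smul]⟩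
  have hne : ∀ α ∈ CE, -α ≠ α := fun α hα => X.neg_ne_self_of_reducedNorm_pos hα.2.1
  -- the injection `LI × Bool → CE`
  let φ : LI × Bool → CE := fun Ib => if Ib.2 then ⟨f Ib.1, hfCE Ib.1⟩ else ⟨-f Ib.1, hneg _ (hfCE Ib.1)⟩
  have hφ : Function.Injective φ := by
    rintro ⟨I, b⟩ ⟨I', b'⟩ h
    have hval : (if b then f I else -f I) = (if b' then f I' else -f I') := by
      have := congrArg Subtype.val h
      by_cases hb : b <;> by_cases hb' : b' <;> simpa [φ, hb, hb'] using this
    have hII' : (I : Set X.B) = I' := by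
      rw [hfI I, hfI I']
      by_cases hb : b <;> by_cases hb' : b' <;> simp only [hb, hb', if_true, if_false,
        Bool.false_eq_true] at hval
      · rw [hval]
      · rw [hval, X.image_mul_right_neg]
      · rw [← X.image_mul_right_neg, hval]
      · rw [neg_inj.mp hval]
    have hI : I = I' := Subtype.ext hII'
    subst hI
    by_cases hb : b <;> by_cases hb' : b' <;> simp only [hb, hb', if_true, if_false,
      Bool.false_eq_true] at hval
    · simp [hb, hb']
    · exact absurd hval.symm (hne _ (hfCE I))
    · exact absurd hval (hne _ (hfCE I))
    · simp [hb, hb']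
  have hLIfin : Finite LI := by
    refine Finite.of_injective (fun I : LI => (⟨f I, hfCE I⟩ : CE)) fun I I' h => ?_
    have h' : f I = f I' := by simpa using h
    exact Subtype.ext (by rw [hfI I, hfI I', h'])
  refine ⟨Set.finite_coe_iff.mp hLIfin, ?_⟩
  have := Nat.card_le_card_of_injective φ hφ
  rwa [Nat.card_prod, Nat.card_eq_fintype_card (α := Bool), Fintype.card_bool, mul_comm] at this

/-! ### 3. `N(F₀, T) ≤ 2 A(T)` -/

/-- **Over `F₀` an ideal has at most the two lattice points `±α`**: if two points of `F₀` in the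
same `Γ`-orbit differ by `±1` only, then `α, β ∈ O` of positive norm with `O α = O β` and
`ι(α) • i, ι(β) • i ∈ F₀` satisfy `β = ±α` (membership in `O` is implied by `O α = O β ∋ α, β`). [folklore] -/
theorem eq_or_eq_neg_of_image_eq (F₀ : Set UpperHalfPlane)
    (huniq : ∀ z ∈ F₀, ∀ γ ∈ X.Gamma, γ • z ∈ F₀ → γ = 1 ∨ γ = -1)
    {α β : X.B} (hα0 : 0 < reducedNorm ℚ X.B α)
    (hβ0 : 0 < reducedNorm ℚ X.B β) {gα gβ : GL (Fin 2) ℝ}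
    (hgα : (gα : Matrix (Fin 2) (Fin 2) ℝ) = X.ι α) (hgβ : (gβ : Matrix (Fin 2) (Fin 2) ℝ) = X.ι β)
    (hzα : gα • UpperHalfPlane.I ∈ F₀) (hzβ : gβ • UpperHalfPlane.I ∈ F₀)
    (heq : (fun o : X.B => o * α) '' (X.O : Set X.B) = (fun o : X.B => o * β) '' (X.O : Set X.B)) :
    β = α ∨ β = -α := by
  obtain ⟨γ, hγ, hι⟩ := X.exists_mem_Gamma_ι_eq_mul hα0 hβ0 heq
  have hg : gβ = γ * gα := Units.ext (by rw [Units.val_mul, hgα, hgβ, hι])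
  rw [hg, mul_smul] at hzβ
  rcases huniq _ hzα γ hγ hzβ with rfl | rfl
  · left
    exact X.ι_injective (by rw [← hgβ, hg, one_mul, hgα])
  · right
    exact X.ι_injective (by rw [← hgβ, hg, Units.val_mul, Units.val_neg, Units.val_one, hgα, map_neg,
      neg_one_mul])

/-- **`N(F₀, T) ≤ 2 A(T)`.** If two points of `F₀` in the same `Γ`-orbit differ by `±1` only, the
map `α ↦ O α` from the lattice points over `F₀` to the principal left ideals is at most two-to-one.
[cite: VignerasLNM800, Ch. IV §1, Ch. V §2 (preuve de la formule de masse)] -/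
theorem card_coneElems_le (F₀ : Set UpperHalfPlane) (T : ℝ)
    (huniq : ∀ z ∈ F₀, ∀ γ ∈ X.Gamma, γ • z ∈ F₀ → γ = 1 ∨ γ = -1)
    (hfin : {I : Set X.B | ∃ α ∈ X.O, 0 < reducedNorm ℚ X.B α ∧ ((reducedNorm ℚ X.B α : ℚ) : ℝ) ≤ T ∧
      I = (fun o : X.B => o * α) '' (X.O : Set X.B)}.Finite) :
    Nat.card {α : X.B | α ∈ X.O ∧ 0 < reducedNorm ℚ X.B α ∧ ((reducedNorm ℚ X.B α : ℚ) : ℝ) ≤ T ∧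
        ∃ g : GL (Fin 2) ℝ, (g : Matrix (Fin 2) (Fin 2) ℝ) = X.ι α ∧ g • UpperHalfPlane.I ∈ F₀} ≤
      2 * Nat.card {I : Set X.B | ∃ α ∈ X.O, 0 < reducedNorm ℚ X.B α ∧
          ((reducedNorm ℚ X.B α : ℚ) : ℝ) ≤ T ∧ I = (fun o : X.B => o * α) '' (X.O : Set X.B)} := by
  classical
  set CE : Set X.B := {α : X.B | α ∈ X.O ∧ 0 < reducedNorm ℚ X.B α ∧
    ((reducedNorm ℚ X.B α : ℚ) : ℝ) ≤ T ∧
      ∃ g : GL (Fin 2) ℝ, (g : Matrix (Fin 2) (Fin 2) ℝ) = X.ι α ∧ g • UpperHalfPlane.I ∈ F₀} with hCE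
  set LI : Set (Set X.B) := {I : Set X.B | ∃ α ∈ X.O, 0 < reducedNorm ℚ X.B α ∧
    ((reducedNorm ℚ X.B α : ℚ) : ℝ) ≤ T ∧ I = (fun o : X.B => o * α) '' (X.O : Set X.B)} with hLI
  haveI : Finite LI := hfin.to_subtype
  -- the ideal of a lattice point
  have hmem : ∀ α ∈ CE, (fun o : X.B => o * α) '' (X.O : Set X.B) ∈ LI := by
    rintro α ⟨hα, hα0, hαT, -⟩
    exact ⟨α, hα, hα0, hαT, rfl⟩
  -- a chosen lattice point in each fibre
  let c : LI → X.B := fun I =>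
    if h : ∃ α ∈ CE, (fun o : X.B => o * α) '' (X.O : Set X.B) = I then h.choose else 0
  have hc : ∀ I : LI, ∀ α ∈ CE, (fun o : X.B => o * α) '' (X.O : Set X.B) = I →
      c I ∈ CE ∧ (fun o : X.B => o * c I) '' (X.O : Set X.B) = I := by
    intro I α hα hαI
    have h : ∃ α ∈ CE, (fun o : X.B => o * α) '' (X.O : Set X.B) = I := ⟨α, hα, hαI⟩
    simp only [c, dif_pos h]
    exact h.choose_spec
  -- fibres have at most the two elements `±(c I)`
  have hfib : ∀ α ∈ CE, ∀ β ∈ CE,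
      (fun o : X.B => o * α) '' (X.O : Set X.B) = (fun o : X.B => o * β) '' (X.O : Set X.B) →
      β = α ∨ β = -α := by
    rintro α ⟨-, hα0, -, gα, hgα, hzα⟩ β ⟨-, hβ0, -, gβ, hgβ, hzβ⟩ heq
    exact X.eq_or_eq_neg_of_image_eq F₀ huniq hα0 hβ0 hgα hgβ hzα hzβ heq
  have hne : ∀ α ∈ CE, -α ≠ α := fun α hα => X.neg_ne_self_of_reducedNorm_pos hα.2.1
  let ψ : CE → LI × Bool := fun α =>
    (⟨_, hmem α α.2⟩, decide ((α : X.B) = c ⟨_, hmem α α.2⟩))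
  have hψ : Function.Injective ψ := by
    rintro ⟨α, hα⟩ ⟨β, hβ⟩ h
    simp only [ψ, Prod.mk.injEq, Subtype.mk.injEq] at h
    obtain ⟨hI, hb⟩ := h
    rcases hfib α hα β hβ hI with rfl | rfl
    · rfl
    · exfalso
      have hsub : (⟨_, hmem α hα⟩ : LI) = ⟨_, hmem (-α) hβ⟩ := Subtype.ext hI
      rw [← hsub, decide_eq_decide] at hb
      set I : LI := ⟨_, hmem α hα⟩ with hIdef
      have hcI := hc I α hα rfl
      rcases hfib α hα (c I) hcI.1 hcI.2.symm with h1 | h1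
      · exact hne α hα ((hb.mp h1.symm).trans h1)
      · exact hne α hα ((hb.mpr h1.symm).trans h1).symm
  have := Nat.card_le_card_of_injective ψ hψ
  rwa [Nat.card_prod, Nat.card_eq_fintype_card (α := Bool), Fintype.card_bool, mul_comm] at this

end ShimuraCurveData

end Literature.NumberTheory.Automorphic

end
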